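import Literature.NumberTheory.EllipticCurves.HeegnerPointsKolyvaginEulerSystem
import Mathlib.RingTheory.Int.Basic
import Mathlib.Algebra.EuclideanDomain.Int
import Mathlib.Algebra.BigOperators.Fin
import Mathlib.Data.Fin.VecNotation
import Mathlib.Tactic.LinearCombination
import Mathlib.Tactic.Module
import Mathlib.Tactic.FinCases
import HarnessLib

/-!
# Kolyvagin's theorem, level 4: Gross's §10 proved, Proposition 2.3 from its three deep leaves

Fifth file of the decomposition of the named fact
`Literature.NumberTheory.EllipticCurves.kolyvagin` (Kolyvagin 1990, Thm. A = Gross 1991, Thm. 1.3)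
along B. H. Gross, *Kolyvagin's work on modular elliptic curves* (LMS Lecture Note Ser. 153,
1991). The leaf `Gross1991_prop_2_3` of
`HeegnerPointsKolyvaginDescentProofs` (*"`Sel(E/K)_p` is cyclic, generated by `δ y_K`"*, recorded
as `#Sel(E/K)_p = p`) is **proved** here from the three named facts of
`HeegnerPointsKolyvaginEulerSystem` — Kolyvagin's classes with Props. 5.4 (2) and 6.2
(`Gross1991_kolyvaginClasses`), local Tate duality with reciprocity (`Gross1991_prop_8_2`) and the
Čebotarev application for `τ`-eigenclasses (`McCallum1991_cor_3_2_eigen`) — by carrying out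
**Gross's §10** (Claim 10.1, Prop. 10.2 (6) ⟹ (1), Claim 10.3, and the count over the two
eigenspaces) in Lean:

* `KolyvaginDescent.Hypotheses.claim_10_1`, `.c_eq_zero`, `.claim_10_3`, `.sel_eq_zmultiples`,
  `.card_sel` — §10 for the abstract data `KolyvaginDescent.Hypotheses` (pure algebra in an
  abelian group killed by an odd prime `p`; McCallum's Cor. 3.2 supplies every Čebotarev choice of
  §10 — each time for a family of `τ`-eigenclasses, as its corrected form requires — so Gross's
  Props. 9.1–9.6 are not needed);
* `exists_hypotheses_of_leaves`, `selmerGroup_eq_zmultiples_of_leaves` (Prop. 2.3 as printed: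
  `Sel(E/K)_p = ℤ · δ y_K`), `Gross1991_prop_2_3_of_leaves` (`#Sel(E/K)_p = p`) — the
  instantiation: `V = H¹(K, E[p])` (`galH1Torsion`, killed by
  `p`: tree `zsmul_discreteH1_torsion`), `τ = conjAct W c p` for the non-trivial `c ∈ Aut(K/ℚ)`
  (`exists_conj_of_isImaginaryQuadratic`: an imaginary quadratic field is a Galois quadratic
  extension of `ℚ`), an involution (`conjAct_conjAct_of_mul_self`) preserving `Sel(E/K)_p`
  (`conjAct_mem_selmerGroup`, proved in `SelmerGaloisAction`: `K` is totally complex), the places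
  `HeightOneSpectrum (𝓞 K) ⊕ InfinitePlace K` with `Loc` the tree's `selmerLocalKer`
  (`mem_selmerGroup_iff`), `A ℓ = ⨅_{v ∋ ℓ} torsionLocalKer`, `y = δ P` (`kummerClassOfPoint`, in
  `Sel` and non-zero since `p ∤ P`), and `ε`, `c(n)` from `Gross1991_kolyvaginClasses`;
* `kolyvagin_of_leaves` — **`kolyvagin N W K` from six named facts**: the three above, Serre's open
  image theorem (`serre_open_image`), and Kolyvagin's two refinements that Gross's text only
  describes (`Kolyvagin1990_sha_primary_finite`, `Kolyvagin1990_thmA_of_hasCM_or_discr`), through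
  the proved `kolyvagin_of_Gross1991_prop_2_3`.

History: the second version of this file migrated it from the superseded
`KolyvaginDescent.Setting` / `McCallum1991_cor_3_2` (whose Čebotarev clause lacked the
`τ`-eigenclass hypothesis and was false in that generality — *Erratum* in the module docstring of
`HeegnerPointsKolyvaginEulerSystem`) to `KolyvaginDescent.Hypotheses` /
`McCallum1991_cor_3_2_eigen`; a transitional third version withdrew the §10 theorems for the
minutes during which those superseded declarations were deleted upstream, and this fourth
version restores them verbatim. The proofs are those of the first version: every Čebotarev
choice of §10 is made for `τ`-eigenclasses (`δ y_K ∈ V^{ε}`, `s ∈ Sel^{±ε}`, `c(ℓ') ∈ V^{-ε}`),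
with the eigen-signs handed over explicitly.

## State of the decomposition of `kolyvagin` after this file

```
kolyvagin N W K  ⇐  kolyvagin_of_leaves (PROVED) from the named facts
├─ Gross1991_kolyvaginClasses   [Gross 1991, (4.4), Props. 5.4 (2), 6.2]  (CM theory, ring
│                                 class fields, Eichler–Shimura, Néron models)
├─ Gross1991_prop_8_2           [Gross 1991, Prop. 8.2]  (local Tate duality, reciprocity for Br K)
├─ McCallum1991_cor_3_2_eigen   [McCallum 1991, Cor. 3.2]  (Čebotarev density theorem)
├─ serre_open_image             [Serre 1972, Thm. 2]  (OpenImage.lean)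
├─ Kolyvagin1990_sha_primary_finite     [Gross 1991, Thm. 1.3 (2), §2; McCallum 1991, §1]
└─ Kolyvagin1990_thmA_of_hasCM_or_discr [McCallum 1991, §1; Gross 1991, Thm. 1.3]
proved glue: §10 (this file), §2 (`Gross1991_prop_2_1_of_prop_2_3`, `…cofinite_of_prop_2_1`,
`kolyvagin_of_Gross1991`), `E(K)[p] = 0` (`torsionBy_eq_bot_of_isImaginaryQuadratic`), the
`Gal(K/ℚ)`-action on `H¹(K, E[p])` and the stability of `Sel` (`SelmerGaloisAction`), Mordell–Weil,
(2.2), `Ш` torsion (tree).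
```

## References

* B. H. Gross, *Kolyvagin's work on modular elliptic curves*, in *`L`-functions and arithmetic
  (Durham, 1989)*, LMS Lecture Note Ser. 153, CUP (1991), 235–256: §10 (Claim 10.1, Prop. 10.2,
  Claim 10.3; PDF pp. 229–231 of the held volume), with Props. 5.4, 6.2, 8.2. [GrossLMS1991]
* W. G. McCallum, *Kolyvagin's work on Shafarevich–Tate groups*, same volume, 295–316, §3,
  Cor. 3.2. [McCallumLMS1991]
-/

noncomputable section

open scoped Classical

open WeierstrassCurve NumberField IsDedekindDomain

universe u

namespace Literature.NumberTheory.EllipticCurves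

namespace KolyvaginDescent

/-! ## Algebra in an abelian group killed by an odd prime -/

section Torsion

variable {V : Type*} [AddCommGroup V] {p : ℕ}

/-- In an abelian group killed by the prime `p`, a non-zero element has annihilator exactly `pℤ`.
[folklore] -/
theorem zsmul_eq_zero_iff_dvd (hp : p.Prime) (hV : ∀ v : V, (p : ℤ) • v = 0) {y : V} (hy : y ≠ 0)
    (a : ℤ) : a • y = 0 ↔ (p : ℤ) ∣ a := by
  constructor
  · intro ha
    by_contra hnd
    have hirr : Irreducible (p : ℤ) := (Nat.prime_iff_prime_int.mp hp).irreducible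
    have hcop : IsCoprime (p : ℤ) a := (Irreducible.coprime_iff_not_dvd hirr).mpr hnd
    obtain ⟨u, v, huv⟩ := hcop
    apply hy
    calc y = (1 : ℤ) • y := (one_zsmul y).symm
      _ = (u * p + v * a) • y := by rw [huv]
      _ = 0 := by rw [add_zsmul, mul_zsmul, mul_zsmul, hV, ha, smul_zero, smul_zero, add_zero]
  · rintro ⟨k, rfl⟩
    rw [mul_comm, mul_zsmul, hV, smul_zero]

/-- In an abelian group killed by an odd prime `p`, `2 • v = 0` forces `v = 0`. [folklore] -/
theorem eq_zero_of_two_zsmul (hp : p.Prime) (hp2 : p ≠ 2) (hV : ∀ v : V, (p : ℤ) • v = 0)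
    {v : V} (hv : (2 : ℤ) • v = 0) : v = 0 := by
  by_contra hne
  have h2 : (p : ℤ) ∣ 2 := (zsmul_eq_zero_iff_dvd hp hV hne 2).mp hv
  have : p ∣ 2 := by exact_mod_cast h2
  rcases (Nat.dvd_prime Nat.prime_two).mp this with h | h
  · exact hp.one_lt.ne' h
  · exact hp2 h

/-- An inverse of `2` modulo the odd prime `p`, acting on a group killed by `p`. [folklore] -/
theorem exists_two_mul_zsmul_eq (hp : p.Prime) (hp2 : p ≠ 2) (hV : ∀ v : V, (p : ℤ) • v = 0) :
    ∃ u : ℤ, ∀ v : V, (2 * u) • v = v := by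
  have hirr : Irreducible (p : ℤ) := (Nat.prime_iff_prime_int.mp hp).irreducible
  have hnd : ¬ (p : ℤ) ∣ 2 := by
    intro h
    have : p ∣ 2 := by exact_mod_cast h
    rcases (Nat.dvd_prime Nat.prime_two).mp this with h' | h'
    · exact hp.one_lt.ne' h'
    · exact hp2 h'
  obtain ⟨a, u, hau⟩ := (Irreducible.coprime_iff_not_dvd hirr).mpr hnd
  refine ⟨u, fun v ↦ ?_⟩
  have : (2 * u : ℤ) = 1 - a * p := by linarith
  rw [this, sub_zsmul, one_zsmul, mul_zsmul, hV, smul_zero]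
  simp

end Torsion

/-! ## Gross 1991, §10 for the abstract hypotheses -/

namespace Hypotheses

variable {V : Type*} [AddCommGroup V] {Pl : Type*} (S : Hypotheses V Pl)

/-- `ε² = 1`. [folklore] -/
theorem ε_mul_ε : S.ε * S.ε = 1 := by
  rcases S.hε with h | h <;> simp [h]

/-- `-ε = ±1`. [folklore] -/
theorem neg_ε_sign : -S.ε = 1 ∨ -S.ε = -1 := by
  rcases S.hε with h | h <;> simp [h]

/-- `δ y_K` lies in the `ε`-eigenspace of `τ` (Prop. 5.4 (2) at `n = 1`, `c(1) = δ y_K`; Gross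
1991, §10: "`δ y_K` lies in the `ε`-eigenspace of `Sel(E/K)_p`").
[cite: GrossLMS1991, §10 (first paragraph)] -/
theorem τ_y : S.τ S.y = S.ε • S.y := by
  have := S.τ_c 1 (kolSupp_one _)
  rwa [Nat.primeFactors_one, Finset.card_empty, pow_zero, mul_one, S.c_one] at this

/-- `c(ℓ)` lies in the `-ε`-eigenspace (Prop. 5.4 (2), `f_ℓ = 1`).
[cite: GrossLMS1991, Prop. 5.4 (2)] -/
theorem τ_c_prime {ℓ : ℕ} (hℓ : S.Kol ℓ) : S.τ (S.c ℓ) = (-S.ε) • S.c ℓ := by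
  have := S.τ_c ℓ (kolSupp_prime (S.prime_of_kol ℓ hℓ) hℓ)
  rwa [card_primeFactors_prime (S.prime_of_kol ℓ hℓ), pow_one, mul_neg_one] at this

/-- `c(ℓℓ')` lies in the `ε`-eigenspace for distinct Kolyvagin primes (Prop. 5.4 (2),
`f_{ℓℓ'} = 2`). [cite: GrossLMS1991, Prop. 5.4 (2)] -/
theorem τ_c_mul {ℓ ℓ' : ℕ} (hℓ : S.Kol ℓ) (hℓ' : S.Kol ℓ') (hne : ℓ ≠ ℓ') :
    S.τ (S.c (ℓ * ℓ')) = S.ε • S.c (ℓ * ℓ') := by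
  have := S.τ_c (ℓ * ℓ') (kolSupp_mul (S.prime_of_kol ℓ hℓ) (S.prime_of_kol ℓ' hℓ') hne hℓ hℓ')
  rwa [card_primeFactors_mul (S.prime_of_kol ℓ hℓ) (S.prime_of_kol ℓ' hℓ') hne, even_two.neg_pow,
    one_pow, mul_one] at this

/-- `d(ℓ)_λ = 0` iff `y_K ∈ pE(K_λ)`, i.e. iff `(δ y_K)_λ = 0` (Prop. 6.2 (2) with `m = 1`; Gross
1991, §6, Note: "is locally trivial at `λ` if and only if `P₁ = y_K ∈ pE(K_λ)`").
[cite: GrossLMS1991, §6 (Note after Prop. 6.2)] -/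
theorem c_mem_loc_pl_iff {ℓ : ℕ} (hℓ : S.Kol ℓ) : S.c ℓ ∈ S.Loc (S.pl ℓ) ↔ S.y ∈ S.A ℓ := by
  have := S.c_mem_loc_iff ℓ 1 hℓ (by rw [mul_one]; exact kolSupp_prime (S.prime_of_kol ℓ hℓ) hℓ)
  rwa [mul_one, S.c_one] at this

/-- `d(ℓ)` is locally trivial away from `λ` (Prop. 6.2 (1)). [cite: GrossLMS1991, Prop. 6.2 (1)] -/
theorem c_mem_loc_of_ne {ℓ : ℕ} (hℓ : S.Kol ℓ) {v : Pl} (hv : v ≠ S.pl ℓ) : S.c ℓ ∈ S.Loc v :=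
  S.c_mem_loc ℓ (kolSupp_prime (S.prime_of_kol ℓ hℓ) hℓ) v fun h ↦ hv ((S.dv_iff ℓ hℓ v).mp h)

/-! ### Linear independence from eigenvalues -/

/-- Two non-zero vectors in opposite eigenspaces of the involution `τ` are independent over
`ℤ/p` (`p` odd): apply `τ` to a relation and add/subtract. [folklore] -/
theorem indep_of_eigen {y s : V} {e : ℤ} (he : e * e = 1) (hy : S.τ y = e • y)
    (hs : S.τ s = (-e) • s) (hy0 : y ≠ 0) (hs0 : s ≠ 0) {a₀ a₁ : ℤ}
    (h : a₀ • y + a₁ • s = 0) : (S.p : ℤ) ∣ a₀ ∧ (S.p : ℤ) ∣ a₁ := by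
  have hτ : (a₀ * e) • y + (-(a₁ * e)) • s = 0 := by
    have := congrArg S.τ h
    rw [map_add, map_zsmul, map_zsmul, map_zero, hy, hs, smul_smul, smul_smul] at this
    rw [← this]
    congr 1
    ring_nf
  have h2a : (2 : ℤ) • (a₀ • y) = 0 := by
    linear_combination (norm := module) h + e • hτ - he • (a₀ • y - a₁ • s)
  have h2b : (2 : ℤ) • (a₁ • s) = 0 := by
    linear_combination (norm := module) h - e • hτ + he • (a₀ • y - a₁ • s)
  exact ⟨(zsmul_eq_zero_iff_dvd S.hp S.torsion hy0 a₀).mp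
      (eq_zero_of_two_zsmul S.hp S.hp2 S.torsion h2a),
    (zsmul_eq_zero_iff_dvd S.hp S.torsion hs0 a₁).mp
      (eq_zero_of_two_zsmul S.hp S.hp2 S.torsion h2b)⟩

/-- A vector outside the line `ℤ y` is independent of `y ≠ 0` over `ℤ/p`. [folklore] -/
theorem indep_of_not_mem {y s : V} (hy0 : y ≠ 0) (hns : ¬ ∃ a : ℤ, s = a • y) {a₀ a₁ : ℤ}
    (h : a₀ • y + a₁ • s = 0) : (S.p : ℤ) ∣ a₀ ∧ (S.p : ℤ) ∣ a₁ := by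
  have h₁ : (S.p : ℤ) ∣ a₁ := by
    by_contra hnd
    have hirr : Irreducible (S.p : ℤ) := (Nat.prime_iff_prime_int.mp S.hp).irreducible
    obtain ⟨u, v, huv⟩ := (Irreducible.coprime_iff_not_dvd hirr).mpr hnd
    apply hns
    refine ⟨-(v * a₀), ?_⟩
    have hs : s = (u * S.p + v * a₁) • s := by rw [huv, one_zsmul]
    rw [hs]
    linear_combination (norm := module) v • h + u • S.torsion s
  have h₁' : a₁ • s = 0 := by
    obtain ⟨k, rfl⟩ := h₁
    rw [mul_comm, mul_zsmul, S.torsion, smul_zero]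
  rw [h₁', add_zero] at h
  exact ⟨(zsmul_eq_zero_iff_dvd S.hp S.torsion hy0 a₀).mp h, h₁⟩

/-! ### Claim 10.1: `Sel^{-ε} = 0` -/

/-- **Gross 1991, Claim 10.1: `Sel(E/K)_p^{-ε} = 0`.** Proof as printed, with McCallum's
Cor. 3.2 in place of Props. 9.5–9.6 and the density statement: given `s ∈ Sel^{-ε}`, `s ≠ 0`, the
classes `δ y_K ∈ V^{ε}` and `s` are independent, so there is a Kolyvagin prime `ℓ` with
`(δ y_K)_λ ≠ 0` and `s_λ ≠ 0`; then `d(ℓ) ∈ H¹(K, E)_p^{-ε}` (Prop. 5.4) is locally trivial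
except at `λ` (Prop. 6.2 (1)) where `d(ℓ)_λ ≠ 0` (Prop. 6.2 (2): *"`d(ℓ)_λ` is trivial if and
only if `y_K = P₁ ∈ pE(K_λ)`"*), and Prop. 8.2 forces `s_λ = 0` — a contradiction.
[cite: GrossLMS1991, §10 Claim 10.1] -/
theorem claim_10_1 {s : V} (hs : s ∈ S.Sel) (hτs : S.τ s = (-S.ε) • s) : s = 0 := by
  by_contra hs0
  -- Čebotarev: a Kolyvagin prime `ℓ` with `y_λ ≠ 0` and `s_λ ≠ 0`
  obtain ⟨ℓ, -, hℓ, hloc⟩ := S.cebotarev 2 ![S.y, s] ![1, 1] (fun i ↦ by fin_cases i <;> simp)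
    (fun i ↦ by
    fin_cases i
    · exact ⟨S.ε, S.hε, S.τ_y⟩
    · exact ⟨-S.ε, S.neg_ε_sign, hτs⟩)
    (fun a ha i ↦ by
    rw [Fin.sum_univ_two] at ha
    simp only [Matrix.cons_val_zero, Matrix.cons_val_one] at ha
    have := S.indep_of_eigen S.ε_mul_ε S.τ_y hτs S.y_ne hs0 ha
    fin_cases i
    · exact this.1
    · exact this.2) 0
  have hy : S.y ∉ S.A ℓ := fun h ↦ by simpa using (hloc 0).mp h
  have hsA : s ∉ S.A ℓ := fun h ↦ by simpa using (hloc 1).mp h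
  -- `d(ℓ)` is locally trivial exactly away from `λ`, and lies in the `-ε`-eigenspace
  have h1 : S.c ℓ ∉ S.Loc (S.pl ℓ) := fun h ↦ hy ((S.c_mem_loc_pl_iff hℓ).mp h)
  exact hsA (S.prop82 ℓ hℓ (-S.ε) S.neg_ε_sign (S.c ℓ) (S.τ_c_prime hℓ)
    (fun v hv ↦ S.c_mem_loc_of_ne hℓ hv) h1 s hs hτs)

/-- **Gross 1991, Prop. 10.2, (6) ⟹ (1): if `y_K ∈ pE(K_λ)` then `c(ℓ) = 0`.** By Prop. 6.2
the class `d(ℓ)` is then locally trivial everywhere, so `c(ℓ) ∈ Sel(E/K)_p^{-ε}`, which is `0` by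
Claim 10.1. [cite: GrossLMS1991, Prop. 10.2] -/
theorem c_eq_zero {ℓ : ℕ} (hℓ : S.Kol ℓ) (hy : S.y ∈ S.A ℓ) : S.c ℓ = 0 := by
  refine S.claim_10_1 ((S.mem_sel_iff _).mpr fun v ↦ ?_) (S.τ_c_prime hℓ)
  by_cases hv : v = S.pl ℓ
  · rw [hv]
    exact (S.c_mem_loc_pl_iff hℓ).mpr hy
  · exact S.c_mem_loc_of_ne hℓ hv

/-! ### Claim 10.3: `Sel^{ε} = ℤ/p · δ y_K` -/

/-- **Gross 1991, Claim 10.3: `Sel(E/K)_p^{ε} = ℤ/p · δ y_K`.** Proof as printed, with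
McCallum's Cor. 3.2 supplying the two Čebotarev choices: if `s ∈ Sel^{ε}` is not a multiple of
`δ y_K`, pick a Kolyvagin prime `ℓ'` with `(δ y_K)_{λ'} ≠ 0`, so that `c(ℓ') ≠ 0` lies in the
`-ε`-eigenspace (*"Let `ℓ'` be a prime such that `c(ℓ')` is non-trivial"*); then `δ y_K, s, c(ℓ')`
are independent, and there is a Kolyvagin prime `ℓ ≠ ℓ'` with `(δ y_K)_λ = 0`, `s_λ ≠ 0`,
`c(ℓ')_λ ≠ 0`. By Prop. 10.2 `c(ℓ) = 0`, hence (Prop. 6.2 (2)) `d(ℓℓ')_{λ'} = 0`, while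
`d(ℓℓ')_λ ≠ 0`; so `d(ℓℓ') ∈ H¹(K, E)_p^{ε}` is locally trivial exactly off `λ`, and Prop. 8.2 gives
`s_λ = 0` — a contradiction. [cite: GrossLMS1991, §10 Claim 10.3] -/
theorem claim_10_3 {s : V} (hs : s ∈ S.Sel) (hτs : S.τ s = S.ε • s) : ∃ a : ℤ, s = a • S.y := by
  by_contra hns
  -- Step A: an auxiliary Kolyvagin prime `ℓ'` with `c(ℓ') ≠ 0`
  obtain ⟨ℓ', -, hℓ', hloc'⟩ := S.cebotarev 1 ![S.y] ![1] (fun i ↦ by fin_cases i; simp)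
    (fun i ↦ by
    fin_cases i
    exact ⟨S.ε, S.hε, S.τ_y⟩)
    (fun a ha i ↦ by
    rw [Fin.sum_univ_one] at ha
    simp only [Matrix.cons_val_zero] at ha
    fin_cases i
    exact (zsmul_eq_zero_iff_dvd S.hp S.torsion S.y_ne _).mp ha) 0
  have hy' : S.y ∉ S.A ℓ' := fun h ↦ by simpa using (hloc' 0).mp h
  have hc'loc : S.c ℓ' ∉ S.Loc (S.pl ℓ') := fun h ↦ hy' ((S.c_mem_loc_pl_iff hℓ').mp h)
  have hc'0 : S.c ℓ' ≠ 0 := fun h ↦ hc'loc (h ▸ zero_mem _)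
  -- Step B: a Kolyvagin prime `ℓ ≠ ℓ'` with `y_λ = 0`, `s_λ ≠ 0`, `c(ℓ')_λ ≠ 0`
  obtain ⟨ℓ, hlt, hℓ, hloc⟩ := S.cebotarev 3 ![S.y, s, S.c ℓ'] ![0, 1, 1]
    (fun i ↦ by fin_cases i <;> simp)
    (fun i ↦ by
    fin_cases i
    · exact ⟨S.ε, S.hε, S.τ_y⟩
    · exact ⟨S.ε, S.hε, hτs⟩
    · exact ⟨-S.ε, S.neg_ε_sign, S.τ_c_prime hℓ'⟩)
    (fun a ha i ↦ by
    rw [Fin.sum_univ_three] at ha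
    simp only [Matrix.cons_val_zero, Matrix.cons_val_one, Matrix.cons_val] at ha
    -- `a₀ y + a₁ s + a₂ c(ℓ') = 0`; apply `τ`: the `-ε`-component `a₂ c(ℓ')` vanishes
    have hτ : (a 0 * S.ε) • S.y + (a 1 * S.ε) • s + (-(a 2 * S.ε)) • S.c ℓ' = 0 := by
      have := congrArg S.τ ha
      rw [map_add, map_add, map_zsmul, map_zsmul, map_zsmul, map_zero, S.τ_y, hτs,
        S.τ_c_prime hℓ', smul_smul, smul_smul, smul_smul] at this
      rw [← this]
      congr 1
      ring_nf
    have h2 : (2 : ℤ) • (a 2 • S.c ℓ') = 0 := by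
      linear_combination (norm := module) ha - S.ε • hτ +
        S.ε_mul_ε • (a 0 • S.y + a 1 • s - a 2 • S.c ℓ')
    have ha2 : a 2 • S.c ℓ' = 0 := eq_zero_of_two_zsmul S.hp S.hp2 S.torsion h2
    have hd2 : (S.p : ℤ) ∣ a 2 := (zsmul_eq_zero_iff_dvd S.hp S.torsion hc'0 _).mp ha2
    rw [ha2, add_zero] at ha
    have h01 := S.indep_of_not_mem S.y_ne hns ha
    fin_cases i
    · exact h01.1
    · exact h01.2
    · exact hd2) ℓ'
  have hne : ℓ ≠ ℓ' := hlt.ne'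
  have hyA : S.y ∈ S.A ℓ := by simpa using (hloc 0)
  have hsA : s ∉ S.A ℓ := fun h ↦ by simpa using (hloc 1).mp h
  have hc'A : S.c ℓ' ∉ S.A ℓ := fun h ↦ by simpa using (hloc 2).mp h
  -- Step C: the class `d(ℓ ℓ')` is locally trivial except at `λ`, where it is not
  have hcℓ : S.c ℓ = 0 := S.c_eq_zero hℓ hyA
  have hsupp : KolSupp S.Kol (ℓ * ℓ') :=
    kolSupp_mul (S.prime_of_kol ℓ hℓ) (S.prime_of_kol ℓ' hℓ') hne hℓ hℓ'
  have hat' : S.c (ℓ * ℓ') ∈ S.Loc (S.pl ℓ') := by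
    rw [mul_comm] at hsupp ⊢
    rw [S.c_mem_loc_iff ℓ' ℓ hℓ' hsupp, hcℓ]
    exact zero_mem _
  have hat : S.c (ℓ * ℓ') ∉ S.Loc (S.pl ℓ) := fun h ↦
    hc'A ((S.c_mem_loc_iff ℓ ℓ' hℓ hsupp).mp h)
  have hoff : ∀ v, v ≠ S.pl ℓ → S.c (ℓ * ℓ') ∈ S.Loc v := by
    intro v hv
    by_cases hdv : S.Dv v (ℓ * ℓ')
    · rcases S.dv_mul ℓ ℓ' hℓ hℓ' v hdv with h | h
      · exact absurd ((S.dv_iff ℓ hℓ v).mp h) hv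
      · rw [(S.dv_iff ℓ' hℓ' v).mp h]
        exact hat'
    · exact S.c_mem_loc _ hsupp v hdv
  exact hsA (S.prop82 ℓ hℓ S.ε S.hε (S.c (ℓ * ℓ')) (S.τ_c_mul hℓ hℓ' hne) hoff hat s hs hτs)

/-! ### Proposition 2.3: `Sel(E/K)_p = ℤ/p · δ y_K` -/

/-- **Gross 1991, Prop. 2.3 (abstract form): `Sel(E/K)_p = ℤ/p · δ y_K`.** *"We now give the
proof of Proposition 2.3, treating the eigenspaces of `Sel(E/K)_p` in turn"* (§10): every `s ∈ Sel`
decomposes (as `p` is odd and `Sel` is `τ`-stable) into `τ`-eigencomponents `s = s⁺ + s⁻` in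
`Sel`; `s⁻ = 0` by Claim 10.1 and `s⁺ ∈ ℤ · δ y_K` by Claim 10.3.
[cite: GrossLMS1991, Prop. 2.3 (§10)] -/
theorem sel_eq_zmultiples : S.Sel = AddSubgroup.zmultiples S.y := by
  refine le_antisymm (fun s hs ↦ ?_) (AddSubgroup.zmultiples_le.mpr S.y_mem)
  obtain ⟨u, hu⟩ := exists_two_mul_zsmul_eq S.hp S.hp2 S.torsion
  have he := S.ε_mul_ε
  set sp := u • (s + S.ε • S.τ s) with hsp
  set sm := u • (s - S.ε • S.τ s) with hsm
  have hτsp : S.τ sp = S.ε • sp := by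
    simp only [hsp, map_zsmul, map_add, S.τ_τ]
    linear_combination (norm := module) he • (-(u • S.τ s))
  have hτsm : S.τ sm = (-S.ε) • sm := by
    simp only [hsm, map_zsmul, map_sub, S.τ_τ]
    linear_combination (norm := module) he • (-(u • S.τ s))
  have hsp_mem : sp ∈ S.Sel :=
    S.Sel.zsmul_mem (S.Sel.add_mem hs (S.Sel.zsmul_mem (S.τ_mem s hs) _)) _
  have hsm_mem : sm ∈ S.Sel :=
    S.Sel.zsmul_mem (S.Sel.sub_mem hs (S.Sel.zsmul_mem (S.τ_mem s hs) _)) _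
  have hsm0 : sm = 0 := S.claim_10_1 hsm_mem hτsm
  obtain ⟨a, ha⟩ := S.claim_10_3 hsp_mem hτsp
  have hsum : s = sp + sm := by
    simp only [hsp, hsm]
    linear_combination (norm := module) (-1 : ℤ) • hu s
  rw [hsum, hsm0, add_zero, ha]
  exact AddSubgroup.zsmul_mem_zmultiples _ _

/-- **`#Sel(E/K)_p = p`** (Gross 1991, Prop. 2.3: "`Sel(E/K)_p` is cyclic, generated by
`δ y_K`", with `δ y_K ≠ 0` of order `p`). [cite: GrossLMS1991, Prop. 2.3] -/
theorem card_sel : Nat.card S.Sel = S.p := by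
  haveI : Fact S.p.Prime := ⟨S.hp⟩
  rw [S.sel_eq_zmultiples, Nat.card_zmultiples]
  exact addOrderOf_eq_prime (by rw [← natCast_zsmul]; exact S.torsion S.y) S.y_ne

end Hypotheses

end KolyvaginDescent

/-! ## Instantiation: Proposition 2.3 from the leaves, and `kolyvagin` -/

section Instantiation

open KolyvaginDescent

variable (N : ℕ) [NeZero N] (W : WeierstrassCurve ℚ) (K : Type u) [Field K] [NumberField K]

/-- **An imaginary quadratic field has a complex conjugation**: there is `c ∈ Aut(K/ℚ)` with
`c ≠ 1` and `c² = 1` (a quadratic extension in characteristic `0` is Galois, so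
`#Aut(K/ℚ) = [K : ℚ] = 2`; Gross 1991, §5: `Gal(K/ℚ) = ⟨1, τ⟩`). [folklore] -/
theorem exists_conj_of_isImaginaryQuadratic (hK : IsImaginaryQuadratic K) :
    ∃ c : K ≃ₐ[ℚ] K, c ≠ 1 ∧ c * c = 1 := by
  haveI : Algebra.IsQuadraticExtension ℚ K := ⟨hK.1⟩
  have hcard : Nat.card (K ≃ₐ[ℚ] K) = 2 := by rw [IsGalois.card_aut_eq_finrank, hK.1]
  haveI : Finite (K ≃ₐ[ℚ] K) := Nat.finite_of_card_ne_zero (by rw [hcard]; decide)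
  have hnt : Nontrivial (K ≃ₐ[ℚ] K) := Finite.one_lt_card_iff_nontrivial.mp (by rw [hcard]; decide)
  obtain ⟨c, hc⟩ := exists_ne (1 : K ≃ₐ[ℚ] K)
  refine ⟨c, hc, ?_⟩
  have := pow_card_eq_one' (G := K ≃ₐ[ℚ] K) (x := c)
  rwa [hcard, pow_two] at this

variable {N W K}

/-- **The §10 data assembled from the tree and the three leaves.** Under the standing hypotheses
(`E/ℚ` elliptic without CM, `K` imaginary quadratic with `d_K ∉ {-3, -4}` and the Heegner
hypothesis, `y_K = P` a Heegner point, `p` odd with `ρ̄_{E,p}` surjective, `p ∤ P`) there is a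
`KolyvaginDescent.Hypotheses` with `V = H¹(K, E[p])` (killed by `p`: `zsmul_discreteH1_torsion`),
`τ = conjAct W c p` for the complex conjugation `c` (`exists_conj_of_isImaginaryQuadratic`), an
involution (`conjAct_conjAct_of_mul_self`) stabilising `Sel = Sel(E/K)_p`
(`conjAct_mem_selmerGroup`), local conditions `selmerLocalKer` at the places
`HeightOneSpectrum (𝓞 K) ⊕ InfinitePlace K` (`mem_selmerGroup_iff`), strict conditions
`A ℓ = ⨅_{v ∋ ℓ} torsionLocalKer`, `y = δ P` (`kummerClassOfPoint`,
`kummerClassOfPoint_mem_selmerGroup`, `kummerClassOfPoint_ne_zero`), and `ε`, `c(n)` with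
Props. 5.4 (2), 6.2 from `Gross1991_kolyvaginClasses`, Prop. 8.2 from `Gross1991_prop_8_2`,
Cor. 3.2 for the `τ`-eigenclasses handed over by §10 from `McCallum1991_cor_3_2_eigen` (same `c`;
via `Set.Infinite.exists_gt`). [cite: GrossLMS1991, §10 (setting)] -/
theorem exists_hypotheses_of_leaves (hA1 : Gross1991_kolyvaginClasses N W K)
    (hA2 : Gross1991_prop_8_2 N W K) (hA3 : McCallum1991_cor_3_2_eigen N W K) [W.IsElliptic]
    (hE : ¬ W.HasCM) (hK : IsImaginaryQuadratic K)
    (hD : NumberField.discr K ≠ -3 ∧ NumberField.discr K ≠ -4) (hH : SatisfiesHeegnerHypothesis N K)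
    {P : (W.baseChange K).toAffine.Point} (hP : IsHeegnerPoint N W K P) {p : ℕ} (hp : p.Prime)
    (hp2 : p ≠ 2) (hρ : W.HasSurjectiveModNGaloisRep p)
    (hdiv : ¬ ∃ Q : (W.baseChange K).toAffine.Point, p • Q = P) :
    ∃ S : Hypotheses (galH1Torsion (W.baseChange K) p) (HeightOneSpectrum (𝓞 K) ⊕ InfinitePlace K),
      S.Sel = selmerGroup (W.baseChange K) p ∧ S.y = kummerClassOfPoint W K hp P ∧ S.p = p := by
  obtain ⟨c, hc, hcc⟩ := exists_conj_of_isImaginaryQuadratic K hK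
  obtain ⟨ε, cl, hε, hc1, hcl⟩ := hA1 hE hK hD hH hP hp hp2 hρ c hc
  exact ⟨
    { p := p
      hp := hp
      hp2 := hp2
      torsion := fun v ↦ zsmul_discreteH1_torsion (p : ℤ) v
      τ := conjAct W c p
      τ_τ := conjAct_conjAct_of_mul_self W hcc p
      Sel := selmerGroup (W.baseChange K) p
      τ_mem := fun s hs ↦ conjAct_mem_selmerGroup W hK.2.isComplex c p hs
      Loc := Sum.elim (fun v ↦ selmerLocalKer (W.baseChange K) (v.adicCompletion K) p)
        (fun w ↦ selmerLocalKer (W.baseChange K) w.Completion p)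
      mem_sel_iff := fun s ↦ by rw [mem_selmerGroup_iff, Sum.forall]; rfl
      Kol := IsKolyvaginPrime N W K p
      prime_of_kol := fun ℓ h ↦ h.prime
      pl := fun ℓ ↦ if h : IsKolyvaginPrime N W K p ℓ then Sum.inl h.place
        else Sum.inr (Classical.arbitrary _)
      Dv := fun v n ↦ Sum.elim (fun v ↦ (n : 𝓞 K) ∈ v.asIdeal) (fun _ ↦ False) v
      dv_iff := fun ℓ hℓ v ↦ by
        rw [dif_pos hℓ]
        rcases v with v | w
        · simp only [Sum.elim_inl, Sum.inl.injEq]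
          exact hℓ.mem_iff
        · simp
      dv_mul := fun ℓ ℓ' _ _ v ↦ by
        rcases v with v | w
        · exact natCast_mul_mem_asIdeal
        · simp
      A := fun ℓ ↦ ⨅ (v : HeightOneSpectrum (𝓞 K)) (_ : (ℓ : 𝓞 K) ∈ v.asIdeal),
        (W.baseChange K).torsionLocalKer (v.adicCompletion K) p
      y := kummerClassOfPoint W K hp P
      y_mem := kummerClassOfPoint_mem_selmerGroup W K hp P
      y_ne := kummerClassOfPoint_ne_zero W K hp hdiv
      ε := ε
      hε := hε
      c := cl
      c_one := hc1
      τ_c := fun n hn ↦ (hcl n hn.1 hn.2).1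
      c_mem_loc := fun n hn v hv ↦ by
        rcases v with v | w
        · exact (hcl n hn.1 hn.2).2.1 v hv
        · exact (hcl n hn.1 hn.2).2.2.1 w
      c_mem_loc_iff := fun ℓ m hℓ hn ↦ by
        rw [dif_pos hℓ]
        simp only [Sum.elim_inl, AddSubgroup.mem_iInf]
        have key := (hcl (ℓ * m) hn.1 hn.2).2.2.2 ℓ hℓ.prime (dvd_mul_right ℓ m) hℓ.place
          hℓ.mem_place
        rw [Nat.mul_div_cancel_left m hℓ.prime.pos] at key
        rw [key]
        constructor
        · intro h v hv
          rwa [hℓ.mem_iff.mp hv]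
        · intro h
          exact h hℓ.place hℓ.mem_place
      prop82 := fun ℓ hℓ ν hν d hd hoff hat s hs hτs ↦ by
        rw [dif_pos hℓ] at hoff hat
        simp only [AddSubgroup.mem_iInf]
        intro v hv
        refine hA2 hE hK hD hH hP hp hp2 hρ c hc hℓ ν hν d hd (fun v' hv' ↦ ?_) (fun w ↦ ?_) v hv
          ?_ s hs hτs
        · exact hoff (Sum.inl v') (fun h ↦ hv' (hℓ.mem_iff.mpr (Sum.inl_injective h)))
        · exact hoff (Sum.inr w) (by simp)
        · rwa [hℓ.mem_iff.mp hv]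
      cebotarev := fun r cs Nv hN hτ hind b ↦ by
        obtain ⟨ℓ, ⟨hℓ, hloc⟩, hlt⟩ := (hA3 hE hK hp hp2 hρ c hc r cs hτ Nv hN hind).exists_gt b
        refine ⟨ℓ, hlt, hℓ, fun i ↦ ?_⟩
        simp only [AddSubgroup.mem_iInf]
        constructor
        · intro h
          exact (hloc i hℓ.place hℓ.mem_place).mp (h hℓ.place hℓ.mem_place)
        · intro h v hv
          exact (hloc i v hv).mpr h }, rfl, rfl, rfl⟩

/-- **Gross 1991, Proposition 2.3 as printed — "the group `Sel(E/K)_p` is cyclic, generated by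
`δ y_K`" — proved from the three leaves**: `Sel(E/K)_p = ℤ · δ P`
(`KolyvaginDescent.Hypotheses.sel_eq_zmultiples`, i.e. Gross's §10, for the data of
`exists_hypotheses_of_leaves`).
[cite: GrossLMS1991, Prop. 2.3 (proof: §10)] -/
theorem selmerGroup_eq_zmultiples_of_leaves (hA1 : Gross1991_kolyvaginClasses N W K)
    (hA2 : Gross1991_prop_8_2 N W K) (hA3 : McCallum1991_cor_3_2_eigen N W K) [W.IsElliptic]
    (hE : ¬ W.HasCM) (hK : IsImaginaryQuadratic K)
    (hD : NumberField.discr K ≠ -3 ∧ NumberField.discr K ≠ -4) (hH : SatisfiesHeegnerHypothesis N K)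
    {P : (W.baseChange K).toAffine.Point} (hP : IsHeegnerPoint N W K P) {p : ℕ} (hp : p.Prime)
    (hp2 : p ≠ 2) (hρ : W.HasSurjectiveModNGaloisRep p)
    (hdiv : ¬ ∃ Q : (W.baseChange K).toAffine.Point, p • Q = P) :
    selmerGroup (W.baseChange K) p = AddSubgroup.zmultiples (kummerClassOfPoint W K hp P) := by
  obtain ⟨S, hS, hy, -⟩ := exists_hypotheses_of_leaves hA1 hA2 hA3 hE hK hD hH hP hp hp2 hρ hdiv
  rw [← hS, ← hy]
  exact S.sel_eq_zmultiples

/-- **Gross 1991, Proposition 2.3 in the form `Gross1991_prop_2_3` (`#Sel(E/K)_p = p`), proved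
from the three leaves** `Gross1991_kolyvaginClasses` (§§3–6), `Gross1991_prop_8_2` (§§7–8) and
`McCallum1991_cor_3_2_eigen` (Čebotarev), by `KolyvaginDescent.Hypotheses.card_sel` (Gross's §10)
for the data of `exists_hypotheses_of_leaves`. [cite: GrossLMS1991, Prop. 2.3 (proof: §10)] -/
theorem Gross1991_prop_2_3_of_leaves (hA1 : Gross1991_kolyvaginClasses N W K)
    (hA2 : Gross1991_prop_8_2 N W K) (hA3 : McCallum1991_cor_3_2_eigen N W K) :
    Gross1991_prop_2_3 N W K := by
  intro _ hE hK hD hH P hP p hp hp2 hρ hdiv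
  obtain ⟨S, hS, -, hpS⟩ := exists_hypotheses_of_leaves hA1 hA2 hA3 hE hK hD hH hP hp hp2 hρ hdiv
  rw [← hS]
  exact S.card_sel.trans hpS

/-- **Kolyvagin's theorem `Literature.NumberTheory.EllipticCurves.kolyvagin` from six named facts**
(the state of its decomposition along Gross 1991 after this file): Kolyvagin's classes with
Props. 5.4 (2), 6.2 (`Gross1991_kolyvaginClasses`), Prop. 8.2 (`Gross1991_prop_8_2`), McCallum's
Cor. 3.2 for `τ`-eigenclasses (`McCallum1991_cor_3_2_eigen`) — giving Prop. 2.3 by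
`Gross1991_prop_2_3_of_leaves` — Serre's
open image theorem (`serre_open_image`), and Kolyvagin's refinements for the finitely many
remaining `p` and for the CM / `d_K ∈ {-3, -4}` cases (`Kolyvagin1990_sha_primary_finite`,
`Kolyvagin1990_thmA_of_hasCM_or_discr`), through the proved `kolyvagin_of_Gross1991_prop_2_3`.
[cite: GrossLMS1991, Thm. 1.3 (via Prop. 2.3, §§2–10)] -/
theorem kolyvagin_of_leaves (hA1 : Gross1991_kolyvaginClasses N W K)
    (hA2 : Gross1991_prop_8_2 N W K) (hA3 : McCallum1991_cor_3_2_eigen N W K)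
    (hS : serre_open_image) (hC : Kolyvagin1990_sha_primary_finite N W K)
    (hexc : Kolyvagin1990_thmA_of_hasCM_or_discr N W K) : kolyvagin N W K :=
  kolyvagin_of_Gross1991_prop_2_3 N W K (Gross1991_prop_2_3_of_leaves hA1 hA2 hA3) hS hC hexc

end Instantiation

end Literature.NumberTheory.EllipticCurves

end
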